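import Literature.Computability.QuantumComplexity.JonesInBQPProofs
import HarnessLib

/-!
# The Hadamard test at the matrix level (AJL §2.2)

Topic `Literature/Computability/QuantumComplexity`; a step towards the named fact
`ajl_mem_PromiseBQPOver_ajlGateSet` (S2 of the decomposition of `ajl_jonesApproxProblem_mem_PromiseBQP`,
`JonesInBQPProofs.lean`): the linear algebra of the Hadamard test used by Algorithm
Approximate-Jones-Plat-Closure (D. Aharonov, V. Jones, Z. Landau, arXiv:quant-ph/0511096, §2.2 and
§3.3): "If a state `|α⟩` can be generated efficiently, and a unitary `Q` can be applied efficiently,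
then there exists an efficient quantum circuit whose output is a random variable `∈ {-1,1}`, and
whose expectation is `Re⟨α|Q|α⟩`" — the circuit being `(H ⊗ 1) · controlled-Q · (H ⊗ 1)` on a
control qubit in `|0⟩`, measured in the computational basis. For the imaginary part AJL (p. 6)
start instead from `(|0⟩ - i|1⟩)/√2 ⊗ |α⟩` and replace the final `H` by `|0⟩ ↦ (|0⟩ + i|1⟩)/√2`,
`|1⟩ ↦ (|0⟩ - i|1⟩)/√2`; we use the equivalent arrangement (same statistics `P(0) = (1 + Im⟨α|Q|α⟩)/2`)
with an extra `S† = S³` on the control between the two Hadamards, i.e. the Hadamard test of `-iQ`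
(the one-line identity `Re(-i z) = Im z`).

* `controlH = placeGate (wireEmb 0) hGate`, the Hadamard gate placed on the control wire `0` of
  `QReg (m+1)` (control first, the convention of `controlledGate`; the `placeGate` form is the one
  produced by `QCircuit.toMatrix`), its entry lemma `controlH_apply_cons`, and
  `hadamardTest U = controlH · controlledGate U · controlH`;
* `hadamardTest_apply_cons_false`: from `|0⟩|x⟩` the amplitude on `|c⟩|y⟩` is
  `(δ_{yx} ± U_{yx})/2` (`+` for `c = 0`);
* `hadamardTest_prob`: for unitary `U` the control reads `c` with probability `(1 ± Re U_{xx})/2`;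
  `hadamardTest_prob_im`: for the Hadamard test of `-iU` (the phase `-i` realised by `S³` on the
  control, `controlledGate_phase_mul`) the probabilities are `(1 ± Im U_{xx})/2` — equivalent to
  AJL's variant (same `P(0)`).

## References

* D. Aharonov, V. Jones, Z. Landau, arXiv:quant-ph/0511096, §2.2 and §3.3 [AharonovJonesLandau2009].
* M. A. Nielsen, I. L. Chuang, *Quantum Computation and Quantum Information*, CUP 2010, §1.3.1,
  §4.3 [NielsenChuang2010].
-/

noncomputable section

open Matrix Complex Finset

namespace Literature.Computability.QuantumComplexity

/-! ### The Hadamard test at the matrix level (AJL §2.2) -/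

section HadamardTest

variable {m : ℕ}

/-- The Hadamard gate placed on the control wire `0` of an `(m+1)`-qubit register:
`placeGate (wireEmb 0) hGate` (the tree's gate placement, `QubitRegister.placeGate`, along the
one-wire embedding `Literature.Computability.QuantumComplexity.wireEmb` of `BQPProofs`). (Nielsen–Chuang §4.3.) [folklore] -/
def controlH : Matrix (Cryptography.QReg (m + 1)) (Cryptography.QReg (m + 1)) ℂ :=
  Cryptography.placeGate (Literature.Computability.QuantumComplexity.wireEmb 0) Cryptography.hGate

/-- Entries of `controlH` against `Fin.cons`-presented strings: `H` on the head, identity on the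
tail. [folklore] -/
theorem controlH_apply_cons (a b : Bool) (s t : Cryptography.QReg m) :
    controlH (Fin.cons a s) (Fin.cons b t) = if s = t then Cryptography.hGate (fun _ => a) (fun _ => b) else 0 := by
  rw [controlH, Cryptography.placeGate_apply]
  have hcond : (∀ i : Fin (m + 1), i ∉ Set.range (Literature.Computability.QuantumComplexity.wireEmb (0 : Fin (m + 1))) →
      (Fin.cons a s : Cryptography.QReg (m + 1)) i = (Fin.cons b t : Cryptography.QReg (m + 1)) i) ↔ s = t := by
    simp only [Literature.Computability.QuantumComplexity.range_wireEmb, Set.mem_singleton_iff]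
    constructor
    · intro h
      funext j
      have := h j.succ (by simp [Fin.succ_ne_zero])
      simpa using this
    · rintro rfl i hi
      obtain ⟨j, rfl⟩ := Fin.exists_succ_eq.2 hi
      simp
  have hH : Cryptography.hGate ((Fin.cons a s : Cryptography.QReg (m + 1)) ∘ Literature.Computability.QuantumComplexity.wireEmb 0)
      ((Fin.cons b t : Cryptography.QReg (m + 1)) ∘ Literature.Computability.QuantumComplexity.wireEmb 0) = Cryptography.hGate (fun _ => a) (fun _ => b) := by
    congr 1
  by_cases hst : s = t
  · rw [if_pos (hcond.2 hst), if_pos hst, hH]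
  · rw [if_neg (fun h => hst (hcond.1 h)), if_neg hst]

/-- The entries of the one-qubit Hadamard matrix: `-1/√2` on `(1,1)`, `1/√2` elsewhere. [cite: NielsenChuang2010, §1.3.1] -/
theorem hGate_apply_const (a b : Bool) :
    Cryptography.hGate (fun _ : Fin 1 => a) (fun _ => b) =
      if a = true ∧ b = true then -(1 / (Real.sqrt 2 : ℂ)) else 1 / (Real.sqrt 2 : ℂ) := by
  simp [Cryptography.hGate]

/-- Sums over an `(m+1)`-qubit register, split along wire `0`. [folklore] -/
theorem sum_qReg_succ (F : Cryptography.QReg (m + 1) → ℂ) : ∑ r, F r = ∑ b : Bool, ∑ t : Cryptography.QReg m, F (Fin.cons b t) := by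
  rw [← Fintype.sum_prod_type', Fintype.sum_equiv (Fin.consEquiv fun _ => Bool)
    (fun cs : Bool × Cryptography.QReg m => F (Fin.cons cs.1 cs.2)) F (fun _ => rfl)]

/-- **The Hadamard-test matrix** `(H ⊗ 1) · (controlled-U) · (H ⊗ 1)` on `1 + m` qubits.
[cite: AharonovJonesLandau2009, §2.2] -/
def hadamardTest (U : Matrix (Cryptography.QReg m) (Cryptography.QReg m) ℂ) : Matrix (Cryptography.QReg (m + 1)) (Cryptography.QReg (m + 1)) ℂ :=
  controlH * controlledGate U * controlH

/-- First half of the Hadamard test: `(H ⊗ 1)(controlled-U)` entrywise. [folklore] -/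
theorem controlH_mul_controlledGate_apply (U : Matrix (Cryptography.QReg m) (Cryptography.QReg m) ℂ) (c b : Bool) (y t : Cryptography.QReg m) :
    (controlH * controlledGate U : Matrix (Cryptography.QReg (m + 1)) (Cryptography.QReg (m + 1)) ℂ) (Fin.cons c y) (Fin.cons b t) =
      Cryptography.hGate (fun _ => c) (fun _ => b) * (if b = true then U y t else if y = t then 1 else 0) := by
  rw [Matrix.mul_apply, sum_qReg_succ]
  simp only [Fintype.sum_bool, controlH_apply_cons, controlledGate_apply_cons, ite_mul, zero_mul,
    Finset.sum_ite_eq, Finset.mem_univ, if_true]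
  cases b <;> simp

/-- **The amplitudes of the Hadamard test** from `|0⟩|x⟩`: control `0` carries `(δ_{yx} + U_{yx})/2`,
control `1` carries `(δ_{yx} - U_{yx})/2`. [cite: AharonovJonesLandau2009, §2.2] -/
theorem hadamardTest_apply_cons_false (U : Matrix (Cryptography.QReg m) (Cryptography.QReg m) ℂ) (c : Bool) (y x : Cryptography.QReg m) :
    hadamardTest U (Fin.cons c y) (Fin.cons false x) =
      ((if y = x then 1 else 0) + (if c = true then -1 else 1) * U y x) / 2 := by
  rw [hadamardTest, Matrix.mul_apply, sum_qReg_succ]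
  simp only [Fintype.sum_bool, controlH_mul_controlledGate_apply, controlH_apply_cons, hGate_apply_const,
    mul_ite, mul_zero, Finset.sum_ite_eq', Finset.mem_univ, if_true, and_true, and_false,
    Bool.false_eq_true, if_false]
  have hs2 : (Real.sqrt 2 : ℂ) ^ 2 = 2 := by
    rw [sq]; exact_mod_cast Real.mul_self_sqrt (by norm_num : (0:ℝ) ≤ 2)
  have hs : (Real.sqrt 2 : ℂ) ≠ 0 := by
    intro h; rw [h, sq, zero_mul] at hs2; norm_num at hs2
  cases c <;> by_cases hyx : y = x <;> simp [hyx] <;> field_simp <;> rw [hs2] <;> ring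

end HadamardTest

section HadamardTestProb

variable {m : ℕ}

/-- Columns of a unitary matrix are unit vectors: `∑_y |U_{yx}|² = 1`. [folklore] -/
theorem sum_norm_sq_col_of_unitary {U : Matrix (Cryptography.QReg m) (Cryptography.QReg m) ℂ} (hU : U ∈ Matrix.unitaryGroup (Cryptography.QReg m) ℂ)
    (x : Cryptography.QReg m) : ∑ y, ‖U y x‖ ^ 2 = 1 := by
  have h := Matrix.mem_unitaryGroup_iff'.1 hU
  have hx := congr_fun (congr_fun h x) x
  rw [Matrix.mul_apply, Matrix.one_apply_eq] at hx
  have : ∑ y, ((Complex.normSq (U y x) : ℝ) : ℂ) = 1 := by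
    rw [← hx]
    refine Finset.sum_congr rfl fun y _ => ?_
    rw [Complex.normSq_eq_conj_mul_self]; rfl
  have hr : ∑ y, Complex.normSq (U y x) = 1 := by exact_mod_cast this
  rw [← hr]
  exact Finset.sum_congr rfl fun y _ => Complex.sq_norm _

/-- The squared modulus of a Hadamard-test amplitude. [folklore] -/
theorem norm_sq_hadamard_amp (δ : Prop) [Decidable δ] (s : ℝ) (hs : s = 1 ∨ s = -1) (u : ℂ) :
    ‖((if δ then (1 : ℂ) else 0) + (s : ℂ) * u) / 2‖ ^ 2 =
      (if δ then (1 + 2 * s * u.re) / 4 else 0) + ‖u‖ ^ 2 / 4 := by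
  have hs2 : s * s = 1 := by rcases hs with rfl | rfl <;> norm_num
  rw [Complex.sq_norm, Complex.sq_norm, Complex.normSq_apply, Complex.normSq_apply]
  split_ifs <;> simp <;> nlinarith [hs2]

/-- **The statistics of the Hadamard test** (AJL §2.2: "a random variable in `{-1, 1}` whose
expectation is `Re⟨α|Q|α⟩`"): started on `|0⟩|x⟩`, the control wire reads `0` with probability
`(1 + Re U_{xx})/2` and `1` with probability `(1 - Re U_{xx})/2`, for unitary `U`.
[cite: AharonovJonesLandau2009, §2.2] -/
theorem hadamardTest_prob {U : Matrix (Cryptography.QReg m) (Cryptography.QReg m) ℂ} (hU : U ∈ Matrix.unitaryGroup (Cryptography.QReg m) ℂ)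
    (c : Bool) (x : Cryptography.QReg m) :
    ∑ y, ‖hadamardTest U (Fin.cons c y) (Fin.cons false x)‖ ^ 2 =
      (1 + (if c = true then -1 else 1) * (U x x).re) / 2 := by
  have key : ∀ y, ‖hadamardTest U (Fin.cons c y) (Fin.cons false x)‖ ^ 2 =
      (if y = x then (1 + 2 * (if c = true then -1 else 1 : ℝ) * (U y x).re) / 4 else 0) + ‖U y x‖ ^ 2 / 4 := by
    intro y
    rw [hadamardTest_apply_cons_false]
    have := norm_sq_hadamard_amp (y = x) (if c = true then -1 else 1 : ℝ) (by cases c <;> simp) (U y x)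
    convert this using 3
    cases c <;> simp
  simp_rw [key]
  rw [Finset.sum_add_distrib, Finset.sum_ite_eq' Finset.univ x, if_pos (Finset.mem_univ _), ← Finset.sum_div,
    sum_norm_sq_col_of_unitary hU x]
  ring

end HadamardTestProb


section HadamardTestIm

variable {m : ℕ}

/-- `-i` is a unitary scalar. [folklore] -/
theorem neg_I_mem_unitary : -Complex.I ∈ unitary ℂ := by
  rw [Unitary.mem_iff]; constructor <;> simp

/-- A phase `c` on the control wire turns the controlled-`U` into the controlled-`(cU)`:
`controlledGate (c • 1) * controlledGate U = controlledGate (c • U)`; for `c = -i` the first factor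
is the Clifford gate `S³ = S†` on the control (Nielsen–Chuang §4.3: a controlled phase is a
one-qubit gate on the control). [cite: NielsenChuang2010, §4.3] -/
theorem controlledGate_phase_mul (U : Matrix (Cryptography.QReg m) (Cryptography.QReg m) ℂ) (c : ℂ) :
    controlledGate (c • (1 : Matrix (Cryptography.QReg m) (Cryptography.QReg m) ℂ)) * controlledGate U = controlledGate (c • U) := by
  rw [controlledGate_mul, Matrix.smul_mul, Matrix.one_mul]

/-- **The imaginary-part variant of the Hadamard test**: the Hadamard test of `-iU` (the extra
phase `-i` = `S³` on the control) reads `0` on the control with probability `(1 + Im U_{xx})/2`.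
AJL (§2.2, p. 6) print a different but equivalent arrangement (start from `(|0⟩ - i|1⟩)/√2`, end
with `|0⟩ ↦ (|0⟩ + i|1⟩)/√2`, `|1⟩ ↦ (|0⟩ - i|1⟩)/√2`) with the same statistics; only `P(0)` is used
(§3.3, the variables `y_j` with expectation `Im⟨α|Q|α⟩`). [cite: AharonovJonesLandau2009, §2.2 and §3.3 (the variables `y_j`)] -/
theorem hadamardTest_prob_im {U : Matrix (Cryptography.QReg m) (Cryptography.QReg m) ℂ} (hU : U ∈ Matrix.unitaryGroup (Cryptography.QReg m) ℂ)
    (c : Bool) (x : Cryptography.QReg m) :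
    ∑ y, ‖hadamardTest ((-Complex.I) • U) (Fin.cons c y) (Fin.cons false x)‖ ^ 2 =
      (1 + (if c = true then -1 else 1) * (U x x).im) / 2 := by
  rw [hadamardTest_prob (Unitary.smul_mem_of_mem neg_I_mem_unitary hU) c x]
  simp [Matrix.smul_apply]

end HadamardTestIm

end Literature.Computability.QuantumComplexity

end
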